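import Literature.AlgebraicGeometry.Resolution.BlowupSequencesExtensions
import Literature.AlgebraicGeometry.Resolution.BlowupSequencesRestrictMarked
import Literature.AlgebraicGeometry.Resolution.KollarGlobalization
import Literature.AlgebraicGeometry.Resolution.KollarOrderReduction
import Literature.AlgebraicGeometry.Resolution.KollarBoundaryFold
import Literature.AlgebraicGeometry.Resolution.KollarEtaleEquivalenceIndep
import Literature.AlgebraicGeometry.Resolution.RegularCentreBlowupOrder
import Literature.AlgebraicGeometry.Resolution.MonomialOrderReductionUnit
import HarnessLib

/-!
# Multiple blow-ups of marked ideals with centres over a closed set: what happens off that set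

Topic: `Literature/AlgebraicGeometry/Resolution`. Bookkeeping for gluing LOCAL resolutions of a
marked ideal (J. Kollár, *Lectures on Resolution of Singularities* (2007), Thm. 3.105 / Prop. 3.37;
E. Bierstone, D. Grigoriev, P. Milman, J. Włodarczyk, arXiv:1206.3090, Def. 3.1.3–3.1.5): along a
multiple blow-up `t` of `M = (X, 𝓘, E, μ)` all of whose centres lie over a closed `T ⊆ X`
(`CentreSeq.CentresOver`, e.g. the extension of a local resolution near a point `x`, `T = {x}`,
`BlowupSequencesExtendOpen.lean`):

* `CentreSeq.CentresOver.isIso_morphismRestrict_comp` — `X_r → X` is an ISOMORPHISM over every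
  open `W` disjoint from `T` (each blow-up is an isomorphism off its centre, GW Prop. 13.91 (3));
  `exists_unique_comp_eq_of_not_mem`, `isIso_stalkMap_comp_of_not_mem`,
  `isClosed_singleton_of_comp_eq` — pointwise consequences off `T`;
* `CentreSeq.IsAdmissibleFor.forall_idealOrder_transformMarked_le` — **the maximal order does
  not increase** along a multiple blow-up of `(𝓘, E, μ)` with `max-ord 𝓘 ≤ μ` (Cossart–Piltant
  2008 Prop. 4.2 (a) / Kollár 3.67 at each step, `IsBlowup.idealOrder_controlledTransform_le_of_forall`);
* `CentreSeq.IsAdmissibleFor.support_boundary_transformMarked_subset` — every member of the final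
  boundary has support over `T ∪ ⋃_{D ∈ E} V(D)` (strict transforms lie over their divisors,
  exceptional divisors over the centres);
* `CentreSeq.support_transformMarked_disjoint_preimage_range` — if `t` induces along an open
  immersion `j` a RESOLUTION of `j^*M` (`IsPullbackAlong j t s`, `s.IsResolutionOf`), then the
  final cosupport of `t` misses the preimage of `j(U)`.

## Sources

* J. Kollár, *Lectures on Resolution of Singularities* (2007): Thm. 3.105, Prop. 3.37, 3.67. [Kollar2007]
* E. Bierstone, D. Grigoriev, P. Milman, J. Włodarczyk, arXiv:1206.3090: Def. 3.1.3–3.1.5,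
  Thm. 8.0.5 (2). [BierstoneGrigorievMilmanWlodarczyk2011]
* V. Cossart, O. Piltant, J. Algebra 320 (2008), proof of Prop. 4.2 (a). [CossartPiltant2008]
* U. Görtz, T. Wedhorn, *Algebraic Geometry I* (2020), Prop. 13.91 (3). [GortzWedhorn2020]
-/

noncomputable section

open CategoryTheory CategoryTheory.Limits AlgebraicGeometry TopologicalSpace IsLocalRing
  Scheme.IdealSheafData

namespace Literature.AlgebraicGeometry.Resolution

universe u

namespace CentreSeq

/-! ## Off `T` the composite is an isomorphism -/

/-- **A multiple blow-up with centres over `T` is an isomorphism over every open disjoint from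
`T`** (each blow-up is an isomorphism off its centre, GW Prop. 13.91 (3)).
[cite: GortzWedhorn2020, Prop. 13.91 (3)] -/
theorem CentresOver.isIso_morphismRestrict_comp : ∀ {X : Scheme.{u}} (s : CentreSeq X)
    {T : Set X}, s.CentresOver T → ∀ (W : X.Opens), Disjoint (W : Set X) T → IsIso (s.comp ∣_ W)
  | X, nil _, _, _, W, _ => by
    change IsIso ((𝟙 X) ∣_ W)
    infer_instance
  | _, cons C rest, T, h, W, hW => by
    obtain ⟨hCT, hrest⟩ := (centresOver_cons C rest T).mp h
    have h1 : IsIso (blowup.π C ∣_ W) :=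
      (blowup.isBlowup C).isIso_morphismRestrict (hW.mono_right hCT)
    have h2 : IsIso (rest.comp ∣_ (blowup.π C ⁻¹ᵁ W)) :=
      CentresOver.isIso_morphismRestrict_comp rest hrest _ (fun V hV hT x hx => by
        have h1 : (blowup.π C) x ∈ (W : Set _) := hV hx
        have h2 : (blowup.π C) x ∈ T := hT hx
        exact (Set.disjoint_left.mp hW h1 h2).elim)
    change IsIso ((rest.comp ≫ blowup.π C) ∣_ W)
    rw [morphismRestrict_comp]
    exact IsIso.comp_isIso' h2 h1

variable {X : Scheme.{u}} {s : CentreSeq X} {T : Set X}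

/-- Over a point `y ∉ T` (`T` closed) there is exactly one point of `X_r`.
[cite: GortzWedhorn2020, Prop. 13.91 (3)] -/
theorem CentresOver.exists_unique_comp_eq_of_not_mem (h : s.CentresOver T) (hT : IsClosed T)
    {y : X} (hy : y ∉ T) : ∃! y' : s.top, s.comp y' = y := by
  let W : X.Opens := ⟨Tᶜ, hT.isOpen_compl⟩
  haveI := h.isIso_morphismRestrict_comp s W (disjoint_compl_left)
  have hsurj := (s.comp ∣_ W).surjective
  have hinj := (s.comp ∣_ W).isOpenEmbedding.injective
  obtain ⟨x, hx⟩ := hsurj ⟨y, hy⟩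
  refine ⟨x.1, by simpa using congrArg Subtype.val hx, fun z hz => ?_⟩
  have hzW : z ∈ s.comp ⁻¹ᵁ W := by
    change s.comp z ∈ (Tᶜ : Set X)
    rw [hz]; exact hy
  have : (⟨z, hzW⟩ : ↥(s.comp ⁻¹ᵁ W)) = x := hinj (Subtype.ext (by
    rw [morphismRestrict_base_coe, hz]
    exact (congrArg Subtype.val hx).symm))
  exact congrArg Subtype.val this

/-- Over the complement of `T` the stalk maps of `X_r → X` are isomorphisms.
[cite: GortzWedhorn2020, Prop. 13.91 (3)] -/
theorem CentresOver.isIso_stalkMap_comp_of_not_mem (h : s.CentresOver T) (hT : IsClosed T)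
    {y' : s.top} (hy : s.comp y' ∉ T) : IsIso (s.comp.stalkMap y') := by
  let W : X.Opens := ⟨Tᶜ, hT.isOpen_compl⟩
  haveI := h.isIso_morphismRestrict_comp s W (disjoint_compl_left)
  have hy' : y' ∈ s.comp ⁻¹ᵁ W := hy
  -- `ι ≫ comp = (comp ∣_ W) ≫ ι_W`, all stalk maps on the right being isomorphisms
  have i1 : IsIso ((s.comp ∣_ W).stalkMap ⟨y', hy'⟩) :=
    (IsOpenImmersion.iff_isIso_stalkMap.mp inferInstance).2 _
  have i2 : IsIso (W.ι.stalkMap ((s.comp ∣_ W) ⟨y', hy'⟩)) :=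
    (IsOpenImmersion.iff_isIso_stalkMap.mp inferInstance).2 _
  have i3 : IsIso ((s.comp ⁻¹ᵁ W).ι.stalkMap ⟨y', hy'⟩) :=
    (IsOpenImmersion.iff_isIso_stalkMap.mp inferInstance).2 _
  have e : (s.comp ⁻¹ᵁ W).ι ≫ s.comp = (s.comp ∣_ W) ≫ W.ι := (morphismRestrict_ι _ _).symm
  have h12 : IsIso (((s.comp ⁻¹ᵁ W).ι ≫ s.comp).stalkMap ⟨y', hy'⟩) := by
    rw [e, Scheme.Hom.stalkMap_comp]
    exact IsIso.comp_isIso' i2 i1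
  rw [Scheme.Hom.stalkMap_comp] at h12
  exact @IsIso.of_isIso_comp_right _ _ _ _ _ (s.comp.stalkMap ((s.comp ⁻¹ᵁ W).ι ⟨y', hy'⟩))
    ((s.comp ⁻¹ᵁ W).ι.stalkMap ⟨y', hy'⟩) i3 h12

/-- Over a closed point `y ∉ T` the point of `X_r` is closed. [cite: GortzWedhorn2020, Prop. 13.91 (3)] -/
theorem CentresOver.isClosed_singleton_of_comp_eq (h : s.CentresOver T) (hT : IsClosed T)
    {y : X} (hy : y ∉ T) (hycl : IsClosed ({y} : Set X)) {y' : s.top} (hy' : s.comp y' = y) :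
    IsClosed ({y'} : Set s.top) := by
  obtain ⟨z, -, hz⟩ := h.exists_unique_comp_eq_of_not_mem hT hy
  have : ({y'} : Set s.top) = s.comp ⁻¹' {y} := by
    ext w
    simp only [Set.mem_singleton_iff, Set.mem_preimage]
    refine ⟨fun hw => by rw [hw, hy'], fun hw => ?_⟩
    rw [hz w hw, hz y' hy']
  rw [this]
  exact hycl.preimage s.comp.continuous

/-! ## Centres lie over the cosupport -/

/-- **The centres of a multiple blow-up of `M` lie over `cosupp M`** (`C_i ⊆ cosupp(M_i)` and
`cosupp(M_i) ⊆ Π⁻¹ cosupp(M)`). [cite: BierstoneGrigorievMilmanWlodarczyk2011, Def. 3.1.3 (1)] -/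
theorem IsAdmissibleFor.centresOver_support : ∀ {X : Scheme.{u}} [IsLocallyNoetherian X]
    (s : CentreSeq X) (M : MarkedIdeal X), s.IsAdmissibleFor M → s.CentresOver M.support
  | _, _, nil _, _, _ => trivial
  | X, _, cons C rest, M, h => by
    obtain ⟨hCsupp, -, -, hrest⟩ := (isAdmissibleFor_cons C rest M).mp h
    haveI : IsLocallyNoetherian (blowup C) := isLocallyNoetherian_blowup C
    refine (centresOver_cons C rest _).mpr ⟨hCsupp, ?_⟩
    exact CentresOver.mono rest (MarkedIdeal.support_transform_subset_preimage (blowup.isBlowup C) M hCsupp)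
      (IsAdmissibleFor.centresOver_support rest _ hrest)

/-! ## The maximal order does not increase -/

/-- **`max-ord` does not increase along a multiple blow-up of `(𝓘, E, μ)` with `max-ord 𝓘 ≤ μ`**
(`X` regular, locally Noetherian): at each step the (regular, reduced) centre lies in
`cosupp(𝓘_i, μ)`, where the order is exactly `μ`, so `ord ≤ μ` persists (Cossart–Piltant 2008,
Prop. 4.2 (a); Kollár 3.67). [cite: CossartPiltant2008, proof of Prop. 4.2 (a)]
[cite: Kollar2007, 3.67] -/
theorem IsAdmissibleFor.forall_idealOrder_transformMarked_le : ∀ {X : Scheme.{u}}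
    [IsLocallyNoetherian X] (s : CentreSeq X) (M : MarkedIdeal X), Scheme.IsRegular X →
      s.IsAdmissibleFor M → (∀ x : X, idealOrder M.ideal x ≤ M.mult) →
      ∀ x' : s.top, idealOrder (s.transformMarked M).ideal x' ≤ M.mult
  | _, _, nil _, _, _, _, hmax, x' => hmax x'
  | X, _, cons C rest, M, hX, hadm, hmax, x' => by
    obtain ⟨hCsupp, hCsnc, hCreg, hrest⟩ := (isAdmissibleFor_cons C rest M).mp hadm
    haveI : IsLocallyNoetherian (blowup C) := isLocallyNoetherian_blowup C
    haveI : IsReduced C.subscheme := hCreg.isReduced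
    have hC : C = vanishingIdeal C.support :=
      eq_vanishingIdeal_support (radical_eq_of_isReduced_subscheme C)
    -- one step
    have hX' : Scheme.IsRegular (blowup C) :=
      (IsMultipleBlowup.single M C (blowup.π C) (blowup.isBlowup C) hCreg hCsupp hCsnc).isRegular hX
    have h1 : ∀ y : blowup C, idealOrder (M.transform (blowup.π C) C).ideal y ≤ M.mult := by
      intro y
      rw [MarkedIdeal.transform_ideal]
      have hπ : IsBlowup (blowup.π C) (vanishingIdeal C.support) := hC ▸ blowup.isBlowup C
      have hreg : Scheme.IsRegular (vanishingIdeal C.support).subscheme := hC ▸ hCreg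
      have hY : ∀ y ∈ (C.support : Set X), idealOrder M.ideal y = M.mult := fun y hy =>
        le_antisymm (hmax y) (hCsupp hy)
      have := hπ.idealOrder_controlledTransform_le_of_forall hX hreg hY hmax y
      rwa [← hC] at this
    exact IsAdmissibleFor.forall_idealOrder_transformMarked_le rest _ hX' hrest h1 x'

/-! ## The boundary stays over `T ∪ ⋃ V(D)` -/

/-- **Every member of the final boundary has support over `T ∪ ⋃_{D ∈ E} V(D)`**: strict
transforms lie over their divisors, exceptional divisors over the centres (which lie over `T`).
[cite: BierstoneGrigorievMilmanWlodarczyk2011, Def. 3.1.3 (4)] -/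
theorem CentresOver.support_boundary_transformMarked_subset : ∀ {X : Scheme.{u}} (s : CentreSeq X)
    (M : MarkedIdeal X) (T : Set X), s.CentresOver T →
      ∀ D' ∈ (s.transformMarked M).boundary,
        ((D'.support : Set s.top)) ⊆
          s.comp ⁻¹' (T ∪ ⋃ D ∈ {D : X.IdealSheafData | D ∈ M.boundary}, (D.support : Set X))
  | _, nil _, M, T, _, D', hD', x, hx =>
    Or.inr (Set.mem_biUnion (show D' ∈ {D | D ∈ M.boundary} from hD') hx)
  | X, cons C rest, M, T, h, D', hD', x, hx => by
    obtain ⟨hCT, hrest⟩ := (centresOver_cons C rest T).mp h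
    rw [transformMarked_cons] at hD'
    have ih := CentresOver.support_boundary_transformMarked_subset rest
      (M.transform (blowup.π C) C) (blowup.π C ⁻¹' T) hrest D' hD' hx
    -- `rest.comp x` lies over `π⁻¹ T` or over the support of a member of the transformed boundary
    show (rest.comp ≫ blowup.π C) x ∈ T ∪ ⋃ D ∈ {D : X.IdealSheafData | D ∈ M.boundary}, (D.support : Set X)
    rw [Scheme.Hom.comp_apply]
    rcases ih with h1 | h1
    · exact Or.inl h1
    · obtain ⟨D₁, hD₁, hxD₁⟩ := Set.mem_iUnion₂.mp h1
      have hD₁' : D₁ ∈ M.boundary.map (strictTransformIdeal (blowup.π C) C) ++ [C.comap (blowup.π C)] := hD₁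
      rw [List.mem_append, List.mem_map, List.mem_singleton] at hD₁'
      rcases hD₁' with ⟨D, hD, rfl⟩ | rfl
      · exact Or.inr (Set.mem_biUnion (show D ∈ {D | D ∈ M.boundary} from hD)
          (mem_support_of_mem_support_strictTransformIdeal hxD₁))
      · refine Or.inl (hCT ?_)
        have : rest.comp x ∈ ((C.comap (blowup.π C)).support : Set _) := hxD₁
        rw [support_comap] at this
        exact this

/-! ## The final cosupport misses the preimage of a resolved open -/

/-- **If `t` induces along the open immersion `j` a resolution of `j^*M`, the final cosupport of
`t` misses the preimage of `j(U)`** (the tower of `t` over `U` is that of `t|U = j^*t`, whose final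
cosupport is empty; BGMW Thm. 8.0.5 (2)). [cite: BierstoneGrigorievMilmanWlodarczyk2011, Thm. 8.0.5 (2)] -/
theorem support_transformMarked_subset_compl_preimage_range {X U : Scheme.{u}} [IsLocallyNoetherian X]
    (t : CentreSeq X) (j : U ⟶ X) [IsOpenImmersion j] (M : MarkedIdeal X) {s : CentreSeq U}
    (hts : IsPullbackAlong j t s) (hs : s.IsResolutionOf (M.comap j)) :
    ((t.transformMarked M).support : Set t.top) ⊆ (t.comp ⁻¹' Set.range j)ᶜ := by
  have hs' : s = t.restrict j := by rw [hts.eq_comap, restrict_eq_comap]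
  subst hs'
  intro x hx hxU
  have hxU' : x ∈ Set.range (t.restrictι j) := by
    rw [range_eq_preimage_range_of_isPullback (isPullback_restrict t j)]; exact hxU
  obtain ⟨x', rfl⟩ := hxU'
  haveI := t.isOpenImmersion_restrictι j
  have h2 := hs.2
  have e := transformMarked_restrict t j M
  change (t.restrict j).transformMarked (M.comap j) = _ at e
  rw [e, ← transformMarked_mult t M, MarkedIdeal.support_comap_of_etale] at h2
  exact (Set.eq_empty_iff_forall_notMem.mp h2) x' hx

end CentreSeq

end Literature.AlgebraicGeometry.Resolution

end
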